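import Literature.RepresentationTheory.HeisenbergGroup.SchwartzBruhatQuadricSupport
import Literature.NumberTheory.Automorphic.LocalFieldAnisotropicCoercive
import Mathlib.LinearAlgebra.QuadraticForm.Basic
import HarnessLib

/-!
# The p-adic uncertainty principle for quadric-supported functionals on `𝒮(K^{ι₁} × K^{ι₂})`
# (IV-4(c1) piece P6 of the Hodge/COR-CM cell, part 2: PARTIAL FOURIER TRANSFORM, UNCERTAINTY, the consumed statement)

Topic `RepresentationTheory/HeisenbergGroup`; namespace `Literature.RepresentationTheory.HeisenbergGroup`.  KERNEL ONLY:
theorems; no definition, no named fact, no record, no `sorry`.  Sequel of `SchwartzBruhatQuadricSupport.lean` (§1–§2 there);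
tools: `sumEndSB`/`boxSB`/`linearMap_ext_boxSB` (`LocalSchwartzBruhatDirectSum`), the Fourier automorphism
`piFourierEquivSB μ₁ hψ hm` and `(1_{a+(𝔭ⁿ)})^ = μ((𝔭ⁿ))·ψ(⟨a,·⟩)·1_{(𝔭^{m−n})}` (`LocalPiSchwartzBruhatFourier`), the coercivity of
anisotropic forms (`LocalFieldAnisotropicCoercive`).  The PARTIAL FOURIER TRANSFORM in the `x'`-variables is the product
operator `ℱ := sumEndSB K e (piFourierEquivSB μ₁ hψ hm) id` (`ℱ_{x'} ⊠ 1`).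

* §3 `exists_locallyConstant_partialFourier_of_vanish_off_box` — if `D` kills everything `ι₁`-supported off the box
  `(𝔭^M)^{ι₁}`, then for every `f₂` and `n ≥ m − M`: `D(ℱ(1_{a+(𝔭ⁿ)^{ι₁}} ⊠ f₂)) = μ₁((𝔭ⁿ)^{ι₁}) · G(a)` with `G` constant on
  cosets of `(𝔭^{m−M})^{ι₁}` («the transform of a compactly supported distribution is uniformly locally constant»).
* §4 `eq_zero_of_vanish_off_box_of_partialFourier_vanish_off_thin` — UNCERTAINTY: if moreover `D ∘ ℱ` kills everything
  `ι₁`-supported off a closed set with EMPTY INTERIOR, then `D = 0` (`G` vanishes on a dense set, hence everywhere; then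
  `D ∘ ℱ` vanishes on all products, `linearMap_ext_boxSB`, and `ℱ` is onto).
* §5 `eq_zero_of_quadric_eigen_of_partialFourier_quadric_eigen` — THE CONSUMED STATEMENT (KEY P6 (a)(b)(c) assembled):
  `Q, Q₂` continuous, level sets of `Q` BOUNDED, of `Q₂` THIN; `D` eigen under all `ψ(b·Q(x'))` and `D ∘ ℱ` eigen under all
  `ψ(b·Q₂(x'))` ⟹ `D = 0`.
* §6 for Mathlib quadratic forms `Q : QuadraticForm K (ι₁ → K)`, ANISOTROPIC and continuous: bounded level sets
  (`QuadraticMap.levelSet_subset_piPrimePowBall_of_anisotropic`, via `exists_coercivity_of_anisotropic`) and, for `ι₁ ≠ ∅`,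
  thin level sets (`QuadraticMap.interior_levelSet_eq_empty_of_anisotropic`).

Consumer: row IV-4(c1) `rankOne_theta_lines_disjoint_holds` (A-p15's plan P1–P7): `D = Λ ∘ M₀⁻¹` on the doubled
oscillator `𝒮(F_v⁶) = 𝒮(F_v⁴ × F_v²)`, `Q = Q₂ = Q'` the anisotropic quaternary second-degree character of the root
subgroup after the polarisation mover, `ℱ` the implementer of the partial Weyl element [MoeglinVignerasWaldspurger1987,
Chap. 2 II.6–II.7].  Folklore p-adic analysis; nothing of the cited sources is asserted.

## References
* [WeilBNT1967] A. Weil, *Basic Number Theory* (1967), Chap. II §2, Chap. VII §2 Prop. 2, Cor. 1.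
* [MoeglinVignerasWaldspurger1987] C. Mœglin, M.-F. Vignéras, J.-L. Waldspurger, LNM 1291 (1987), Chap. 1 I.11, Chap. 2 II.6–II.7.
* [Bruhat1961] F. Bruhat, *Distributions sur un groupe localement compact*, Bull. SMF 89 (1961), §9.
-/

set_option autoImplicit false

noncomputable section

open MeasureTheory Filter
open scoped NNReal Topology Pointwise
open Literature.NumberTheory.Automorphic
open Literature.NumberTheory.GaloisRepresentations.IsNonarchimedeanLocalField

namespace Literature.RepresentationTheory.HeisenbergGroup

/-! ## §3 Compact `ι₁`-support ⇒ the partial Fourier transform of `D` is locally constant on small boxes -/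

section ModulatedBox

variable {K : Type*} [Field K] [ValuativeRel K] [TopologicalSpace K] [IsNonarchimedeanLocalField K]
  {ι₁ : Type*} [Fintype ι₁] {ψ : AddChar K Circle} (hψ : ψ.IsContinuousNontrivial) {m : ℤ} (hm : ψ.HasConductorExp m)

include hψ in
/-- the modulated box `x' ↦ ψ(⟨x', a⟩)·1_{(𝔭^M)^{ι₁}}(x')` is a Schwartz–Bruhat function.
[cite: WeilBNT1967, Chap. VII §2, Prop. 2] -/
theorem addChar_mul_indicator_piPrimePowBall_mem_schwartzBruhat (M : ℤ) (a : ι₁ → K) :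
    (fun x' : ι₁ → K => ((ψ (x' ⬝ᵥ a) : Circle) : ℂ) * (piPrimePowBall K ι₁ M).indicator (fun _ => (1 : ℂ)) x') ∈
      SchwartzBruhat (ι₁ → K) := by
  have h1 := indicator_piPrimePowBall_mem_schwartzBruhat (F := K) (ι := ι₁) M (1 : ℂ)
  rw [mem_schwartzBruhat_iff] at h1 ⊢
  refine ⟨IsLocallyConstant.mul ?_ h1.1, h1.2.mul_left⟩
  exact ((isLocallyConstant_of_isContinuousNontrivial hψ).comp_continuous (continuous_dotProduct_left a)).comp _

include hm in
/-- the modulated box does not change when `a` moves inside `(𝔭^{m−M})^{ι₁}` (`⟨x', t⟩ ∈ 𝔭^m` for `x' ∈ (𝔭^M)^{ι₁}`,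
`t ∈ (𝔭^{m−M})^{ι₁}`, and `ψ` is trivial on `𝔭^m`). [cite: WeilBNT1967, Chap. VII §2, Prop. 2] -/
theorem addChar_mul_indicator_piPrimePowBall_vadd_eq (M : ℤ) (a t : ι₁ → K)
    (ht : t ∈ piPrimePowBall K ι₁ (m - M)) (x' : ι₁ → K) :
    ((ψ (x' ⬝ᵥ (a + t)) : Circle) : ℂ) * (piPrimePowBall K ι₁ M).indicator (fun _ => (1 : ℂ)) x' =
      ((ψ (x' ⬝ᵥ a) : Circle) : ℂ) * (piPrimePowBall K ι₁ M).indicator (fun _ => (1 : ℂ)) x' := by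
  by_cases hx : x' ∈ piPrimePowBall K ι₁ M
  · have hxt : x' ⬝ᵥ t ∈ primePowBall K m := by
      have := dotProduct_mem_primePowBall hx ht
      rwa [add_sub_cancel] at this
    rw [dotProduct_add, AddChar.map_add_eq_mul, hm.1 _ hxt, mul_one]
  · rw [Set.indicator_of_notMem hx, mul_zero, mul_zero]

end ModulatedBox

section PartialFourier

variable {K : Type*} [Field K] [ValuativeRel K] [TopologicalSpace K] [IsNonarchimedeanLocalField K]
  {ι₁ ι₂ ι : Type*} [Fintype ι₁] [Fintype ι₂] [Fintype ι] (e : ι₁ ⊕ ι₂ ≃ ι)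
  [MeasurableSpace (ι₁ → K)] [BorelSpace (ι₁ → K)] (μ₁ : Measure (ι₁ → K)) [μ₁.IsAddHaarMeasure]
  {ψ : AddChar K Circle} (hψ : ψ.IsContinuousNontrivial) {m : ℤ} (hm : ψ.HasConductorExp m)

/-- **(KEY P6 (c), core).**  If `D` kills every `Φ` whose `ι₁`-support avoids the box `(𝔭^M)^{ι₁}` (compact `ι₁`-support),
then the PARTIAL FOURIER TRANSFORM `ℱ = ℱ_{x'} ⊠ 1` (`sumEndSB K e (piFourierEquivSB μ₁ hψ hm) id`) of `D`, tested on
`1_{a + (𝔭ⁿ)^{ι₁}} ⊠ f₂` with `n ≥ m − M`, equals `μ₁((𝔭ⁿ)^{ι₁}) · G(a)` with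
`G(a) = D(ψ(⟨x', a⟩)1_{(𝔭^M)^{ι₁}} ⊠ f₂)` INDEPENDENT of `n` and constant on cosets of `(𝔭^{m−M})^{ι₁}`
(`(1_{a+(𝔭ⁿ)})^ = μ₁((𝔭ⁿ)) ψ(⟨a,·⟩) 1_{(𝔭^{m−n})}` and `(𝔭^M) ⊆ (𝔭^{m−n})`). [cite: WeilBNT1967, Chap. VII §2, Cor. 1] -/
theorem exists_locallyConstant_partialFourier_of_vanish_off_box (D : SchwartzBruhat (ι → K) →ₗ[ℂ] ℂ) {M : ℤ}
    (hD : ∀ Φ : SchwartzBruhat (ι → K),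
      (∀ x, (Φ : (ι → K) → ℂ) x ≠ 0 → resL e x ∉ piPrimePowBall K ι₁ M) → D Φ = 0)
    (f₂ : SchwartzBruhat (ι₂ → K)) :
    ∃ G : (ι₁ → K) → ℂ, (∀ a, ∀ t ∈ piPrimePowBall K ι₁ (m - M), G (a + t) = G a) ∧
      ∀ (a : ι₁ → K) (n : ℤ), m - M ≤ n →
        D (sumEndSB K e (piFourierEquivSB μ₁ hψ hm).toLinearMap LinearMap.id
            (boxSB K e ⟨(a +ᵥ piPrimePowBall K ι₁ n).indicator fun _ => (1 : ℂ),
              indicator_vadd_piPrimePowBall_mem_schwartzBruhat n a 1⟩ f₂)) =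
          (μ₁.real (piPrimePowBall K ι₁ n) : ℂ) * G a := by
  classical
  refine ⟨fun a => D (boxSB K e ⟨_, addChar_mul_indicator_piPrimePowBall_mem_schwartzBruhat hψ M a⟩ f₂),
    fun a t ht => ?_, fun a n hn => ?_⟩
  · -- local constancy of `G`
    have : (⟨_, addChar_mul_indicator_piPrimePowBall_mem_schwartzBruhat hψ M (a + t)⟩ : SchwartzBruhat (ι₁ → K)) =
        ⟨_, addChar_mul_indicator_piPrimePowBall_mem_schwartzBruhat hψ M a⟩ :=
      Subtype.ext (funext fun x' => addChar_mul_indicator_piPrimePowBall_vadd_eq hm M a t ht x')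
    simp only [this]
  · -- the formula: the two test functions agree on `resL ⁻¹ (𝔭^M)^{ι₁}`
    rw [← sub_eq_zero, ← smul_eq_mul, ← map_smul, ← map_sub]
    refine hD _ fun x hx hxM => hx ?_
    have hMn : resL e x ∈ piPrimePowBall K ι₁ (m - n) := piPrimePowBall_antitone (by omega) hxM
    rw [Submodule.coe_sub, Submodule.coe_smul, Pi.sub_apply, Pi.smul_apply, smul_eq_mul, sumEndSB_boxSB,
      coe_boxSB, coe_boxSB]
    simp only [LinearMap.id_coe, id_eq, LinearEquiv.coe_coe, coe_piFourierEquivSB]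
    rw [piFourierSB_indicator_vadd_piPrimePowBall μ₁ hm a n (resL e x), if_pos hMn, Set.indicator_of_mem hxM,
      dotProduct_comm a (resL e x)]
    ring

/-! ## §4 The uncertainty principle: compact `ι₁`-support and thin `ι₁`-support of the partial Fourier transform ⇒ `D = 0` -/

include hm in
/-- **UNCERTAINTY.**  If `D` kills everything `ι₁`-supported off the box `(𝔭^M)^{ι₁}` AND `D ∘ ℱ` (ℱ = Fourier in `x'`, identity
in `x''`) kills everything `ι₁`-supported off a closed set `Z ⊆ K^{ι₁}` with EMPTY INTERIOR, then `D = 0`: the locally constant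
germ `G` of §3 vanishes at every point off `Z` (test a small box there), hence everywhere (every coset of `(𝔭^{m−M})^{ι₁}` meets
`Zᶜ`), so `D ∘ ℱ` vanishes on all `1_{a+(𝔭ⁿ)} ⊠ f₂` with `n` large, hence on all products `f₁ ⊠ f₂` (level-`n` decomposition
of `f₁`), hence `D ∘ ℱ = 0` (`linearMap_ext_boxSB`) and `ℱ` is onto. [cite: WeilBNT1967, Chap. VII §2, Prop. 2 and Cor. 1] -/
theorem eq_zero_of_vanish_off_box_of_partialFourier_vanish_off_thin (D : SchwartzBruhat (ι → K) →ₗ[ℂ] ℂ) {M : ℤ}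
    (hD : ∀ Φ : SchwartzBruhat (ι → K),
      (∀ x, (Φ : (ι → K) → ℂ) x ≠ 0 → resL e x ∉ piPrimePowBall K ι₁ M) → D Φ = 0)
    {Z : Set (ι₁ → K)} (hZc : IsClosed Z) (hZi : interior Z = ∅)
    (hDF : ∀ Φ : SchwartzBruhat (ι → K), (∀ x, (Φ : (ι → K) → ℂ) x ≠ 0 → resL e x ∉ Z) →
      D (sumEndSB K e (piFourierEquivSB μ₁ hψ hm).toLinearMap LinearMap.id Φ) = 0) :
    D = 0 := by
  classical
  set ℱ : SchwartzBruhat (ι → K) →ₗ[ℂ] SchwartzBruhat (ι → K) :=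
    sumEndSB K e (piFourierEquivSB μ₁ hψ hm).toLinearMap LinearMap.id with hℱ
  -- Step 1: `D (ℱ (1_{a + (𝔭ⁿ)} ⊠ f₂)) = 0` for all `a` and all `n ≥ m - M`
  have key : ∀ (f₂ : SchwartzBruhat (ι₂ → K)) (a : ι₁ → K) (n : ℤ), m - M ≤ n →
      D (ℱ (boxSB K e ⟨(a +ᵥ piPrimePowBall K ι₁ n).indicator fun _ => (1 : ℂ),
        indicator_vadd_piPrimePowBall_mem_schwartzBruhat n a 1⟩ f₂)) = 0 := by
    intro f₂ a n hn
    obtain ⟨G, hGc, hG⟩ := exists_locallyConstant_partialFourier_of_vanish_off_box e μ₁ hψ hm D hD f₂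
    -- `G` vanishes off `Z`
    have hGZ : ∀ a', a' ∉ Z → G a' = 0 := by
      intro a' ha'
      have hW : (fun t => a' + t) ⁻¹' Zᶜ ∈ 𝓝 (0 : ι₁ → K) :=
        (continuous_const.add continuous_id).continuousAt.preimage_mem_nhds
          (by simpa using hZc.isOpen_compl.mem_nhds ha')
      obtain ⟨n₁, hn₁⟩ := exists_piPrimePowBall_subset_of_mem_nhds_zero hW
      set n' : ℤ := max (m - M) (n₁ : ℤ) with hn'
      have h1 := hG a' n' (le_max_left _ _)
      have h2 : D (ℱ (boxSB K e ⟨(a' +ᵥ piPrimePowBall K ι₁ n').indicator fun _ => (1 : ℂ),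
          indicator_vadd_piPrimePowBall_mem_schwartzBruhat n' a' 1⟩ f₂)) = 0 := by
        refine hDF _ fun x hx hxZ => ?_
        rw [coe_boxSB] at hx
        have hxB : resL e x ∈ a' +ᵥ piPrimePowBall K ι₁ n' := Set.mem_of_indicator_ne_zero (left_ne_zero_of_mul hx)
        obtain ⟨t, ht, hxt⟩ := Set.mem_vadd_set.1 hxB
        have ht₁ : t ∈ piPrimePowBall K ι₁ (n₁ : ℤ) := piPrimePowBall_antitone (le_max_right _ _) ht
        have hmem : a' + t ∈ Zᶜ := hn₁ ht₁
        rw [← vadd_eq_add, hxt] at hmem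
        exact hmem hxZ
      rw [h2] at h1
      have hvol : (μ₁.real (piPrimePowBall K ι₁ n') : ℂ) ≠ 0 := by
        exact_mod_cast (measureReal_piPrimePowBall_pos μ₁ n').ne'
      exact (mul_eq_zero.1 h1.symm).resolve_left hvol
    -- `G` vanishes everywhere: every coset of `(𝔭^{m-M})^{ι₁}` meets `Zᶜ`
    have hG0 : ∀ a', G a' = 0 := by
      intro a'
      have hopen : IsOpen (a' +ᵥ piPrimePowBall K ι₁ (m - M)) := isOpen_vadd_piPrimePowBall _ _
      have hnot : ¬ (a' +ᵥ piPrimePowBall K ι₁ (m - M) ⊆ Z) := fun hsub => by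
        have hint : a' ∈ interior Z := (hopen.subset_interior_iff.2 hsub) (self_mem_vadd_piPrimePowBall _ _)
        rw [hZi] at hint
        exact hint
      obtain ⟨a'', ha''B, ha''Z⟩ := Set.not_subset.1 hnot
      obtain ⟨t, ht, rfl⟩ := Set.mem_vadd_set.1 ha''B
      rw [← hGc a' t ht, ← vadd_eq_add]
      exact hGZ _ ha''Z
    rw [hG a n hn, hG0 a, mul_zero]
  -- Step 2: `D ∘ ℱ` vanishes on every product `f₁ ⊠ f₂`
  have hprod : ∀ (f₁ : SchwartzBruhat (ι₁ → K)) (f₂ : SchwartzBruhat (ι₂ → K)), D (ℱ (boxSB K e f₁ f₂)) = 0 := by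
    intro f₁ f₂
    obtain ⟨N₀, hN₀⟩ := exists_forall_add_eq_of_mem_schwartzBruhat_pi f₁.2
    set n : ℤ := max N₀ (m - M) with hndef
    have hn : ∀ x, ∀ t ∈ piPrimePowBall K ι₁ n, (f₁ : (ι₁ → K) → ℂ) (x + t) = (f₁ : (ι₁ → K) → ℂ) x :=
      forall_add_eq_of_le_pi (le_max_left _ _) hN₀
    obtain ⟨C, rep, hrep, hsum⟩ := exists_finset_eq_sum_const_mul_indicator_pi_of_forall_add_eq f₁.2 hn
    have hf₁ : f₁ = ∑ B ∈ C, (f₁ : (ι₁ → K) → ℂ) (rep B) •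
        (⟨(rep B +ᵥ piPrimePowBall K ι₁ n).indicator fun _ => (1 : ℂ),
          indicator_vadd_piPrimePowBall_mem_schwartzBruhat n (rep B) 1⟩ : SchwartzBruhat (ι₁ → K)) := by
      apply Subtype.ext
      funext u
      rw [hsum u, AddSubmonoidClass.coe_finsetSum, Finset.sum_apply]
      refine Finset.sum_congr rfl fun B hB => ?_
      rw [Submodule.coe_smul, Pi.smul_apply, smul_eq_mul]
      exact congrArg (fun S : Set (ι₁ → K) => (f₁ : (ι₁ → K) → ℂ) (rep B) * S.indicator (fun _ => (1 : ℂ)) u)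
        (hrep B hB)
    have hbox : boxSB K e f₁ f₂ = ∑ B ∈ C, (f₁ : (ι₁ → K) → ℂ) (rep B) •
        boxSB K e ⟨(rep B +ᵥ piPrimePowBall K ι₁ n).indicator fun _ => (1 : ℂ),
          indicator_vadd_piPrimePowBall_mem_schwartzBruhat n (rep B) 1⟩ f₂ := by
      conv_lhs => rw [hf₁]
      simp only [boxSB, TensorProduct.sum_tmul, map_sum, ← TensorProduct.smul_tmul', map_smul]
    rw [hbox, map_sum, map_sum]
    refine Finset.sum_eq_zero fun B _ => ?_
    rw [map_smul, map_smul, smul_eq_mul, key f₂ (rep B) n (le_max_right _ _), mul_zero]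
  -- Step 3: `D ∘ ℱ = 0` and `ℱ` is onto
  have hDF0 : D ∘ₗ ℱ = 0 :=
    linearMap_ext_boxSB K e fun f₁ f₂ => by rw [LinearMap.comp_apply, hprod, LinearMap.zero_apply]
  have hsurj : ℱ ∘ₗ sumEndSB K e (piFourierEquivSB μ₁ hψ hm).symm.toLinearMap LinearMap.id = LinearMap.id := by
    rw [hℱ, ← sumEndSB_comp, LinearEquiv.comp_symm, LinearMap.id_comp, sumEndSB_id]
  refine LinearMap.ext fun Φ => ?_
  have := LinearMap.congr_fun hDF0 (sumEndSB K e (piFourierEquivSB μ₁ hψ hm).symm.toLinearMap LinearMap.id Φ)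
  rw [LinearMap.comp_apply, ← LinearMap.comp_apply (f := ℱ), hsurj] at this
  simpa using this

end PartialFourier

/-! ## §5 The consumed statement: eigen under `ψ(b·Q)` and, after the partial Fourier transform, under `ψ(b·Q₂)` ⇒ `D = 0` -/

section Main

variable {K : Type*} [Field K] [ValuativeRel K] [TopologicalSpace K] [IsNonarchimedeanLocalField K]
  {ι₁ ι₂ ι : Type*} [Fintype ι₁] [Fintype ι₂] [Fintype ι] (e : ι₁ ⊕ ι₂ ≃ ι)
  [MeasurableSpace (ι₁ → K)] [BorelSpace (ι₁ → K)] (μ₁ : Measure (ι₁ → K)) [μ₁.IsAddHaarMeasure]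
  {ψ : AddChar K Circle} (hψ : ψ.IsContinuousNontrivial) {m : ℤ} (hm : ψ.HasConductorExp m)

include hm in
/-- **P6 (the statement consumed by the `rankOne_theta_lines_disjoint_holds` assembly).**  Let `Q, Q₂ : K^{ι₁} → K` be
continuous, the level sets `{Q = c}` BOUNDED (e.g. `Q` an anisotropic quadratic form, §6) and the level sets `{Q₂ = c}`
THIN (empty interior; e.g. `Q₂` an anisotropic quadratic form on `K^{ι₁}`, `ι₁ ≠ ∅`, §6).  Let `D` be a linear functional on
`𝒮(K^{ι₁} × K^{ι₂})` which is an eigenfunctional of every multiplication `Φ ↦ ψ(b·Q(x'))·Φ`, `b ∈ K`, and whose partial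
Fourier transform `D ∘ ℱ` (`ℱ = ℱ_{x'} ⊠ 1 = sumEndSB K e (piFourierEquivSB μ₁ hψ hm) id`) is an eigenfunctional of every
`Φ ↦ ψ(b·Q₂(x'))·Φ`.  Then `D = 0`.  (§2 twice: `D` is carried by a compact quadric shell, `D ∘ ℱ` by a thin one; §4.)
In the cell's application `Q = Q₂ = Q'` is the anisotropic quaternary second-degree character of the root subgroup of
`U(V)` in the doubled oscillator after the polarisation mover, `D = Λ ∘ M₀⁻¹`, and `ℱ` implements the partial Weyl element
[MoeglinVignerasWaldspurger1987, Chap. 2 II.6–II.7]; if that implementer is `c·T ∘ ℱ` or `c·ℱ ∘ T` for the precomposition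
`T` by a linear automorphism of the `x'`-variables, apply this theorem to `D ∘ T` resp. with `Q₂ ∘ (automorphism)` — the
hypotheses are invariant. [cite: MoeglinVignerasWaldspurger1987, Chap. 2 II.6–II.7] [cite: WeilBNT1967, Chap. VII §2, Prop. 2, Cor. 1] -/
theorem eq_zero_of_quadric_eigen_of_partialFourier_quadric_eigen (Q Q₂ : (ι₁ → K) → K) (hQ : Continuous Q)
    (hQ₂ : Continuous Q₂) (hQb : ∀ c : K, ∃ M : ℤ, ∀ x', Q x' = c → x' ∈ piPrimePowBall K ι₁ M)
    (hQ₂i : ∀ c : K, interior {x' : ι₁ → K | Q₂ x' = c} = ∅)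
    (D : SchwartzBruhat (ι → K) →ₗ[ℂ] ℂ)
    (hD : ∀ b : K, ∃ κ : ℂ, ∀ Φ Ψ : SchwartzBruhat (ι → K),
      (∀ x, (Ψ : (ι → K) → ℂ) x = ((ψ (b * Q (resL e x)) : Circle) : ℂ) * (Φ : (ι → K) → ℂ) x) → D Ψ = κ * D Φ)
    (hDF : ∀ b : K, ∃ κ : ℂ, ∀ Φ Ψ : SchwartzBruhat (ι → K),
      (∀ x, (Ψ : (ι → K) → ℂ) x = ((ψ (b * Q₂ (resL e x)) : Circle) : ℂ) * (Φ : (ι → K) → ℂ) x) →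
        D (sumEndSB K e (piFourierEquivSB μ₁ hψ hm).toLinearMap LinearMap.id Ψ) =
          κ * D (sumEndSB K e (piFourierEquivSB μ₁ hψ hm).toLinearMap LinearMap.id Φ)) :
    D = 0 := by
  classical
  haveI : T2Space K := (isLocalField K).toT2Space
  rcases exists_quadric_support_of_mulChar_eigen e hψ Q hQ D hD with h0 | ⟨q₀, hq₀⟩
  · exact h0
  obtain ⟨M, hM⟩ := hQb q₀
  have hDbox : ∀ Φ : SchwartzBruhat (ι → K),
      (∀ x, (Φ : (ι → K) → ℂ) x ≠ 0 → resL e x ∉ piPrimePowBall K ι₁ M) → D Φ = 0 :=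
    fun Φ hΦ => hq₀ Φ fun x hx hq => hΦ x hx (hM _ hq)
  rcases exists_quadric_support_of_mulChar_eigen e hψ Q₂ hQ₂
      (D ∘ₗ sumEndSB K e (piFourierEquivSB μ₁ hψ hm).toLinearMap LinearMap.id) hDF with h0 | ⟨q₀', hq₀'⟩
  · exact eq_zero_of_vanish_off_box_of_partialFourier_vanish_off_thin e μ₁ hψ hm D hDbox isClosed_empty interior_empty
      fun Φ _ => LinearMap.congr_fun h0 Φ
  · exact eq_zero_of_vanish_off_box_of_partialFourier_vanish_off_thin e μ₁ hψ hm D hDbox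
      (isClosed_eq hQ₂ continuous_const) (hQ₂i q₀') fun Φ hΦ => hq₀' Φ fun x hx h => hΦ x hx h

end Main

/-! ## §6 Anisotropic quadratic forms: bounded and thin level sets -/

section QuadraticForms

variable {K : Type*} [Field K] [ValuativeRel K] [TopologicalSpace K] [IsNonarchimedeanLocalField K]
  {ι₁ : Type*} [Fintype ι₁]

/-- **the level sets of a continuous ANISOTROPIC quadratic form are bounded** (`|Q(x)| ≥ q^{-k₀}‖x‖²`,
`exists_coercivity_of_anisotropic`). [cite: WeilBNT1967, Chap. II §1 Prop. 1 Cor. 1–2] -/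
theorem _root_.QuadraticMap.levelSet_subset_piPrimePowBall_of_anisotropic (Q : QuadraticForm K (ι₁ → K))
    (hQa : Q.Anisotropic) (hQc : Continuous Q) (c : K) :
    ∃ M : ℤ, ∀ x : ι₁ → K, Q x = c → x ∈ piPrimePowBall K ι₁ M := by
  classical
  obtain ⟨k₀, hk₀⟩ := exists_coercivity_of_anisotropic (ι := ι₁) two_ne_zero Q hQc
    (fun a x => by rw [QuadraticMap.map_smul, smul_eq_mul, sq]) hQa
  set ρ : ℝ≥0 := ((residueFieldCard K : ℝ≥0)⁻¹) with hρ
  have hρ0 : 0 < ρ := inv_residueFieldCard_pos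
  have hρ1 : ρ < 1 := inv_residueFieldCard_lt_one
  -- the bound `R = ρ^{-k₀} |c|` on `‖x‖²`, and `n` with `R < (ρ⁻¹)^n ≤ ((ρ⁻¹)^n)²`
  set R : ℝ≥0 := ρ ^ (-k₀) * normAbs K c with hR
  have hr1 : 1 < ρ⁻¹ := one_lt_inv₀ hρ0 |>.2 hρ1
  obtain ⟨n, hn⟩ := pow_unbounded_of_one_lt R hr1
  refine ⟨-(n : ℤ), fun x hx => ?_⟩
  set S : ℝ≥0 := Finset.univ.sup fun i => normAbs K (x i) with hS
  have h1 : ρ ^ k₀ * S ^ 2 ≤ normAbs K c := by rw [← hx]; exact hk₀ x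
  have h2 : S ^ 2 ≤ R := by
    rw [hR]
    calc S ^ 2 = ρ ^ (-k₀) * (ρ ^ k₀ * S ^ 2) := by
          rw [← mul_assoc, ← zpow_add₀ hρ0.ne', neg_add_cancel, zpow_zero, one_mul]
      _ ≤ ρ ^ (-k₀) * normAbs K c := mul_le_mul' le_rfl h1
  have h3 : S ^ 2 < ((ρ⁻¹) ^ n) ^ 2 := by
    refine lt_of_le_of_lt h2 (lt_of_lt_of_le hn ?_)
    calc (ρ⁻¹) ^ n = (ρ⁻¹) ^ n * 1 := (mul_one _).symm
      _ ≤ (ρ⁻¹) ^ n * (ρ⁻¹) ^ n := mul_le_mul' le_rfl (one_le_pow₀ hr1.le)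
      _ = ((ρ⁻¹) ^ n) ^ 2 := (sq _).symm
  have h4 : S < (ρ⁻¹) ^ n := lt_of_pow_lt_pow_left₀ 2 zero_le h3
  refine mem_piPrimePowBall_iff.2 fun i => (mem_primePowBall_iff).2 ?_
  have : normAbs K (x i) ≤ S := Finset.le_sup (f := fun i => normAbs K (x i)) (Finset.mem_univ i)
  refine this.trans (h4.le.trans (le_of_eq ?_))
  rw [hρ, zpow_neg, zpow_natCast, inv_pow]

/-- **the level sets of an ANISOTROPIC quadratic form on `K^{ι₁}`, `ι₁ ≠ ∅`, have empty interior**: if `Q ≡ c` near `x₀`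
then `Q(h) + polar(x₀, h) = 0 = t²Q(h) + t·polar(x₀, h)` for all small `h` and `|t| ≤ 1`, so `Q(h) = 0`, `h = 0`.
[cite: MoeglinVignerasWaldspurger1987, Chap. 1 I.11] -/
theorem _root_.QuadraticMap.interior_levelSet_eq_empty_of_anisotropic [Nonempty ι₁] (Q : QuadraticForm K (ι₁ → K))
    (hQa : Q.Anisotropic) (c : K) : interior {x : ι₁ → K | Q x = c} = ∅ := by
  classical
  by_contra hne
  obtain ⟨x₀, hx₀⟩ := Set.nonempty_iff_ne_empty.2 hne
  have hU : {x : ι₁ → K | Q x = c} ∈ 𝓝 x₀ := mem_interior_iff_mem_nhds.1 hx₀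
  have hW : (fun h => x₀ + h) ⁻¹' {x : ι₁ → K | Q x = c} ∈ 𝓝 (0 : ι₁ → K) :=
    (continuous_const.add continuous_id).continuousAt.preimage_mem_nhds (by simpa using hU)
  obtain ⟨n, hn⟩ := exists_piPrimePowBall_subset_of_mem_nhds_zero hW
  have hQ0 : Q x₀ = c := (mem_of_mem_nhds hU : x₀ ∈ {x : ι₁ → K | Q x = c})
  -- a non-zero small vector `h` and a scalar `t` with `|t| < 1`, `t ≠ 0, 1`
  set i : ι₁ := Classical.arbitrary ι₁
  obtain ⟨a, ha0, ha⟩ := exists_normAbs_eq_inv_zpow_of_int (F := K) (n : ℤ)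
  set h : ι₁ → K := Pi.single i a with hh
  have hhB : h ∈ piPrimePowBall K ι₁ (n : ℤ) := single_mem_piPrimePowBall i ((mem_primePowBall_iff).2 ha.le)
  have hh0 : h ≠ 0 := fun h0 => ha0 (by simpa [hh] using congrFun h0 i)
  obtain ⟨t, ht0, ht⟩ := exists_normAbs_eq_inv_zpow_of_int (F := K) (1 : ℤ)
  have ht1 : t ≠ 1 := by
    intro h1
    rw [h1, map_one, zpow_one] at ht
    exact inv_residueFieldCard_lt_one.ne' ht
  have hthB : t • h ∈ piPrimePowBall K ι₁ (n : ℤ) := by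
    refine mem_piPrimePowBall_iff.2 fun j => (mem_primePowBall_iff).2 ?_
    rw [Pi.smul_apply, smul_eq_mul, map_mul, ht, zpow_one]
    calc (residueFieldCard K : ℝ≥0)⁻¹ * normAbs K (h j) ≤ 1 * normAbs K (h j) :=
          mul_le_mul' inv_residueFieldCard_lt_one.le le_rfl
      _ = normAbs K (h j) := one_mul _
      _ ≤ _ := (mem_primePowBall_iff).1 (mem_piPrimePowBall_iff.1 hhB j)
  -- the two expansions
  have e1 : Q (x₀ + h) = c := hn hhB
  have e2 : Q (x₀ + t • h) = c := hn hthB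
  rw [QuadraticMap.map_add Q x₀ h, hQ0] at e1
  rw [QuadraticMap.map_add Q x₀ (t • h), hQ0, QuadraticMap.map_smul, QuadraticMap.polar_smul_right, smul_eq_mul,
    smul_eq_mul] at e2
  have e3 : Q h + QuadraticMap.polar Q x₀ h = 0 := by linear_combination e1
  have e4 : t * (t - 1) * Q h = 0 := by linear_combination e2 - t * e3
  rcases mul_eq_zero.1 e4 with h5 | h5
  · rcases mul_eq_zero.1 h5 with h6 | h6
    · exact ht0 h6
    · exact ht1 (sub_eq_zero.1 h6)
  · exact hh0 (hQa h h5)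

end QuadraticForms

end Literature.RepresentationTheory.HeisenbergGroup

end
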